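import Mathlib.MeasureTheory.Measure.Portmanteau
import Mathlib.MeasureTheory.Measure.Regular
import Mathlib.Topology.MetricSpace.Thickening
import Literature.Probability.RandomPlanarGeometry.SAWTargetOrder
import HarnessLib

/-!
# Hall/Strassen stochastic domination along a closed relation passes to weak limits

Topic `Literature/Probability/RandomPlanarGeometry` (the order-theoretic layer `StochDominatedAlong`
of `SAWTargetOrder.lean`).  The basic closure property of the stochastic order under weak
convergence (Kamae–Krengel–O'Brien 1977 for closed partial orders on Polish spaces; Liggett,
*Interacting particle systems*, Ch. II, §2, for compact spaces via monotone continuous functions),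
in the relation form used by the tree: if the Hall inequalities `μₙ U ≤ νₙ (R[U])`
(`R[U] = {y | ∃ x ∈ U, R x y}`) hold for all OPEN `U` at every late stage (in particular if
`StochDominatedAlong R (μs n) (νs n)`), the graph of `R` is closed, and `μₙ → μ`, `νₙ → ν` weakly
(probability measures on (pseudo)metric spaces), then `μ K ≤ ν (R[K])` for every compact `K`,
hence for every measurable `A` when `μ` is inner regular (automatic for finite measures on Polish
spaces).  Since the output (measurable sets) is stronger than the input (open sets), the theorem
composes with itself (iterated limits, e.g. mesh `→ 0` then target `→ b`).  More generally the
stage-`n` relations may only be asymptotically inside each member of a decreasing sequence of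
closed relations `R k`; the limit is then dominated along `⋂ₖ R k`
(`measure_le_relImage_of_tendsto_of_antitone`).  This is the measure-theoretic skeleton of "a
lattice left–right order of interfaces passes to subsequential scaling limits" (route
`CriticalPhenomena/SAWTargetMonotonicity`, endpoint squeeze); the other two abstract steps of a
two-sided stochastic squeeze are in `StochasticSqueeze.lean`.

## Contents

* `isClosed_relImage_of_isCompact` — `R[K]` is closed for `K` compact and `R` closed.
* `iInter_closure_relImage_thickening` — `⋂ₙ closure (R[K_{1/(n+1)}]) = R[K]` (`K_η` the open
  `η`-thickening), the topological heart of the limit passage.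
* `measure_le_relImage_of_tendsto_of_isCompact` / `…_of_measurableSet` — the closure theorem
  (Hall inequalities on open sets at the stages), for `ProbabilityMeasure`-valued families
  converging in Mathlib's topology of weak convergence along any filter;
  `measure_le_relImage_of_tendsto_of_antitone[_of_measurableSet]` — decreasing closed relations;
  `StochDominatedAlong.measure_le_of_tendsto_of_isCompact` etc. — the same from full domination.
* The sequential test-function forms (interface of `IsSubseqLimitLaw`), the antisymmetry step and
  the pull-back step of a two-sided squeeze are in `StochasticSqueeze.lean`.

Proof of the closure theorem: portmanteau (`ProbabilityMeasure.le_liminf_measure_open_of_tendsto`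
on the open thickening `K_η`, `ProbabilityMeasure.limsup_measure_closed_le_of_tendsto` on
`closure (R[K_η])`), then continuity from above along `η = 1/(n+1)` and compactness of `K` (closed
graph ⇒ the intersection is `R[K]`).  The conclusion is stated for compact / measurable sets: for
a non-measurable `A` the outer-measure inequality is not a consequence in general.

## References

* T. Kamae, U. Krengel, G. L. O'Brien, *Stochastic inequalities on partially ordered spaces*,
  Ann. Probab. 5 (1977), 899–912 (closedness of the stochastic order under weak convergence).
* T. M. Liggett, *Interacting particle systems* (1985/2005), Ch. II, Def. 2.1–Thm. 2.4.
* P. Billingsley, *Convergence of probability measures*, 2nd ed. (1999), Thm. 2.1 (portmanteau).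
-/

noncomputable section

open MeasureTheory Filter Set Metric
open scoped Topology ENNReal NNReal BoundedContinuousFunction

namespace Literature.Probability.RandomPlanarGeometry

variable {X Y : Type*} [PseudoMetricSpace X] [PseudoMetricSpace Y]

/-! ### Topology: images of compact sets under closed relations -/

/-- The image `R[K] = {y | ∃ x ∈ K, R x y}` of a compact set under a relation with closed graph is
closed (projection along a compact factor). [folklore] -/
theorem isClosed_relImage_of_isCompact {R : X → Y → Prop} (hR : IsClosed {p : X × Y | R p.1 p.2})
    {K : Set X} (hK : IsCompact K) : IsClosed {y | ∃ x ∈ K, R x y} := by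
  refine IsSeqClosed.isClosed fun u y hu huy => ?_
  choose x hxK hxR using hu
  obtain ⟨a, haK, φ, hφ, hφa⟩ := hK.tendsto_subseq hxK
  refine ⟨a, haK, ?_⟩
  have hlim : Tendsto (fun n => (x (φ n), u (φ n))) atTop (𝓝 (a, y)) :=
    hφa.prodMk_nhds (huy.comp hφ.tendsto_atTop)
  exact hR.mem_of_tendsto hlim (Eventually.of_forall fun n => hxR (φ n))

/-- For a compact `K` and a closed relation `R`, the closed sets `closure (R[K_η])`, `K_η` the open
`η`-thickening of `K`, shrink to `R[K]` along `η = 1/(n+1)`. [folklore] -/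
theorem iInter_closure_relImage_thickening {R : X → Y → Prop}
    (hR : IsClosed {p : X × Y | R p.1 p.2}) {K : Set X} (hK : IsCompact K) :
    ⋂ n : ℕ, closure {y | ∃ x ∈ thickening (1 / ((n : ℝ) + 1)) K, R x y} = {y | ∃ x ∈ K, R x y} := by
  refine Subset.antisymm ?_ ?_
  · intro y hy
    rw [mem_iInter] at hy
    -- approximants: `yₙ` close to `y`, `xₙ` in the thickening related to `yₙ`, `kₙ ∈ K` close to `xₙ`
    have hstep : ∀ n : ℕ, ∃ k ∈ K, ∃ x y', dist x k < 1 / ((n : ℝ) + 1) ∧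
        dist y y' < 1 / ((n : ℝ) + 1) ∧ R x y' := by
      intro n
      have hpos : (0 : ℝ) < 1 / ((n : ℝ) + 1) := Nat.one_div_pos_of_nat
      obtain ⟨y', hy', hyy'⟩ := Metric.mem_closure_iff.1 (hy n) _ hpos
      obtain ⟨x, hx, hxy'⟩ := hy'
      obtain ⟨k, hk, hxk⟩ := mem_thickening_iff.1 hx
      exact ⟨k, hk, x, y', hxk, hyy', hxy'⟩
    choose k hkK x y' hxk hyy' hR' using hstep
    obtain ⟨a, haK, φ, hφ, hφa⟩ := hK.tendsto_subseq hkK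
    refine ⟨a, haK, ?_⟩
    have h0 : Tendsto (fun n : ℕ => 1 / ((n : ℝ) + 1)) atTop (𝓝 0) :=
      tendsto_one_div_add_atTop_nhds_zero_nat
    have h0φ : Tendsto (fun n : ℕ => 1 / (((φ n : ℕ) : ℝ) + 1)) atTop (𝓝 0) :=
      h0.comp hφ.tendsto_atTop
    -- `x (φ n) → a`
    have hxa : Tendsto (fun n => x (φ n)) atTop (𝓝 a) := by
      rw [Metric.tendsto_nhds] at hφa ⊢
      intro ε hε
      have h1 := hφa (ε / 2) (half_pos hε)
      have h2 := (Metric.tendsto_nhds.1 h0φ) (ε / 2) (half_pos hε)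
      filter_upwards [h1, h2] with n hn1 hn2
      rw [Real.dist_eq, sub_zero, abs_of_pos (Nat.one_div_pos_of_nat)] at hn2
      calc dist (x (φ n)) a ≤ dist (x (φ n)) (k (φ n)) + dist (k (φ n)) a := dist_triangle _ _ _
        _ < ε / 2 + ε / 2 := add_lt_add ((hxk (φ n)).trans hn2) hn1
        _ = ε := add_halves ε
    -- `y' (φ n) → y`
    have hyy : Tendsto (fun n => y' (φ n)) atTop (𝓝 y) := by
      rw [Metric.tendsto_nhds]
      intro ε hε
      have h2 := (Metric.tendsto_nhds.1 h0φ) ε hε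
      filter_upwards [h2] with n hn2
      rw [Real.dist_eq, sub_zero, abs_of_pos (Nat.one_div_pos_of_nat)] at hn2
      rw [dist_comm]
      exact (hyy' (φ n)).trans hn2
    exact hR.mem_of_tendsto (hxa.prodMk_nhds hyy) (Eventually.of_forall fun n => hR' (φ n))
  · refine subset_iInter fun n => ?_
    refine Subset.trans ?_ subset_closure
    rintro y ⟨x, hx, hxy⟩
    exact ⟨x, self_subset_thickening Nat.one_div_pos_of_nat K hx, hxy⟩

/-! ### The closure theorem (Hall inequalities on open sets at the stages) -/

section Closure

variable [MeasurableSpace X] [OpensMeasurableSpace X] [MeasurableSpace Y] [OpensMeasurableSpace Y]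
  {ι : Type*} {L : Filter ι}

/-- **Hall inequalities along a closed relation pass to weak limits (compact sets).** If, at
every late stage of a non-trivial filter, `μs i U ≤ νs i (R[U])` for every open `U`, the graph of
`R` is closed and `μs → μ`, `νs → ν` weakly, then `μ K ≤ ν (R[K])` for every compact `K`.
Portmanteau on the open thickening `K_η` and on the closed set `closure (R[K_η])`, then
`η = 1/(n+1) → 0` by continuity from above (`iInter_closure_relImage_thickening`).
(Kamae–Krengel–O'Brien 1977; Liggett Ch. II §2.) [folklore] -/
theorem measure_le_relImage_of_tendsto_of_isCompact [NeBot L] {R : X → Y → Prop}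
    (hR : IsClosed {p : X × Y | R p.1 p.2})
    {μs : ι → ProbabilityMeasure X} {μ : ProbabilityMeasure X}
    {νs : ι → ProbabilityMeasure Y} {ν : ProbabilityMeasure Y}
    (hμ : Tendsto μs L (𝓝 μ)) (hν : Tendsto νs L (𝓝 ν))
    (h : ∀ᶠ i in L, ∀ U : Set X, IsOpen U →
      (μs i : Measure X) U ≤ (νs i : Measure Y) {y | ∃ x ∈ U, R x y})
    {K : Set X} (hK : IsCompact K) :
    (μ : Measure X) K ≤ (ν : Measure Y) {y | ∃ x ∈ K, R x y} := by
  -- the shrinking closed sets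
  set F : ℕ → Set Y := fun n => closure {y | ∃ x ∈ thickening (1 / ((n : ℝ) + 1)) K, R x y}
    with hF
  have hstage : ∀ n : ℕ, (μ : Measure X) K ≤ (ν : Measure Y) (F n) := by
    intro n
    set G : Set X := thickening (1 / ((n : ℝ) + 1)) K with hG
    have hGopen : IsOpen G := isOpen_thickening
    calc (μ : Measure X) K ≤ (μ : Measure X) G :=
          measure_mono (self_subset_thickening Nat.one_div_pos_of_nat K)
      _ ≤ L.liminf fun i => (μs i : Measure X) G :=
          ProbabilityMeasure.le_liminf_measure_open_of_tendsto hμ hGopen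
      _ ≤ L.liminf fun i => (νs i : Measure Y) (F n) := by
          refine liminf_le_liminf (h.mono fun i hi => ?_)
          exact (hi G hGopen).trans (measure_mono subset_closure)
      _ ≤ L.limsup fun i => (νs i : Measure Y) (F n) := liminf_le_limsup
      _ ≤ (ν : Measure Y) (F n) :=
          ProbabilityMeasure.limsup_measure_closed_le_of_tendsto hν isClosed_closure
  have hanti : Antitone F := by
    intro m n hmn
    refine closure_mono fun y => ?_
    rintro ⟨x, hx, hxy⟩
    refine ⟨x, thickening_mono ?_ K hx, hxy⟩
    exact one_div_le_one_div_of_le (Nat.cast_add_one_pos m) (by exact_mod_cast Nat.succ_le_succ hmn)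
  have hInter : (ν : Measure Y) (⋂ n, F n) = ⨅ n, (ν : Measure Y) (F n) :=
    hanti.measure_iInter (fun n => isClosed_closure.measurableSet.nullMeasurableSet)
      ⟨0, measure_ne_top _ _⟩
  rw [← iInter_closure_relImage_thickening hR hK, hInter]
  exact le_iInf hstage

/-- **Hall inequalities along a closed relation pass to weak limits (measurable sets).** Under the
hypotheses of `measure_le_relImage_of_tendsto_of_isCompact`, if the limit `μ` is inner regular
with respect to compact sets (e.g. any finite measure on a Polish space), then `μ A ≤ ν (R[A])`
for every measurable `A` — in particular again for every open `A`, so the statement iterates.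
[folklore] -/
theorem measure_le_relImage_of_tendsto_of_measurableSet [NeBot L] {R : X → Y → Prop}
    (hR : IsClosed {p : X × Y | R p.1 p.2})
    {μs : ι → ProbabilityMeasure X} {μ : ProbabilityMeasure X}
    {νs : ι → ProbabilityMeasure Y} {ν : ProbabilityMeasure Y}
    (hμ : Tendsto μs L (𝓝 μ)) (hν : Tendsto νs L (𝓝 ν))
    (h : ∀ᶠ i in L, ∀ U : Set X, IsOpen U →
      (μs i : Measure X) U ≤ (νs i : Measure Y) {y | ∃ x ∈ U, R x y})
    [(μ : Measure X).InnerRegularCompactLTTop] {A : Set X} (hA : MeasurableSet A) :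
    (μ : Measure X) A ≤ (ν : Measure Y) {y | ∃ x ∈ A, R x y} := by
  refine le_of_forall_lt fun r hr => ?_
  obtain ⟨K, hKA, hK, hrK⟩ := hA.exists_lt_isCompact_of_ne_top (measure_ne_top _ _) hr
  refine hrK.trans_le ((measure_le_relImage_of_tendsto_of_isCompact hR hμ hν h hK).trans ?_)
  exact measure_mono fun y ⟨x, hx, hxy⟩ => ⟨x, hKA hx, hxy⟩

/-- **Asymptotic domination along a decreasing sequence of closed relations.** Let `R k`,
`k : ℕ`, be relations with closed graphs, decreasing in `k`, and suppose that for every `k` the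
stage relations `S i` are eventually contained in `R k`, while at every late stage the Hall
inequalities `μs i U ≤ νs i (S i [U])` hold for all open `U`. If `μs → μ` and `νs → ν` weakly,
then `μ K ≤ ν {y | ∃ x ∈ K, ∀ k, R k x y}` for every compact `K`: the limit laws are dominated
along `⋂ₖ R k`. (The form in which a lattice order, exact at every mesh only up to a vanishing
boundary layer, is inherited by scaling limits.) [folklore] -/
theorem measure_le_relImage_of_tendsto_of_antitone [NeBot L] {R : ℕ → X → Y → Prop}
    (hR : ∀ k, IsClosed {p : X × Y | R k p.1 p.2}) (hanti : ∀ k l, k ≤ l → ∀ x y, R l x y → R k x y)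
    {S : ι → X → Y → Prop} (hS : ∀ k, ∀ᶠ i in L, ∀ x y, S i x y → R k x y)
    {μs : ι → ProbabilityMeasure X} {μ : ProbabilityMeasure X}
    {νs : ι → ProbabilityMeasure Y} {ν : ProbabilityMeasure Y}
    (hμ : Tendsto μs L (𝓝 μ)) (hν : Tendsto νs L (𝓝 ν))
    (h : ∀ᶠ i in L, ∀ U : Set X, IsOpen U →
      (μs i : Measure X) U ≤ (νs i : Measure Y) {y | ∃ x ∈ U, S i x y})
    {K : Set X} (hK : IsCompact K) :
    (μ : Measure X) K ≤ (ν : Measure Y) {y | ∃ x ∈ K, ∀ k, R k x y} := by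
  set G : ℕ → Set Y := fun k => {y | ∃ x ∈ K, R k x y} with hG
  -- domination along each `R k`
  have hstage : ∀ k, (μ : Measure X) K ≤ (ν : Measure Y) (G k) := by
    intro k
    refine measure_le_relImage_of_tendsto_of_isCompact (hR k) hμ hν ?_ hK
    filter_upwards [h, hS k] with i hi hSi
    intro U hU
    exact (hi U hU).trans (measure_mono fun y ⟨x, hx, hxy⟩ => ⟨x, hx, hSi x y hxy⟩)
  have hGanti : Antitone G := by
    intro k l hkl y
    rintro ⟨x, hx, hxy⟩
    exact ⟨x, hx, hanti k l hkl x y hxy⟩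
  have hInter : (ν : Measure Y) (⋂ k, G k) = ⨅ k, (ν : Measure Y) (G k) :=
    hGanti.measure_iInter
      (fun k => (isClosed_relImage_of_isCompact (hR k) hK).measurableSet.nullMeasurableSet)
      ⟨0, measure_ne_top _ _⟩
  -- `⋂ₖ R k [K] = (⋂ₖ R k)[K]` by compactness of `K`
  have hset : (⋂ k, G k) = {y | ∃ x ∈ K, ∀ k, R k x y} := by
    refine Subset.antisymm ?_ ?_
    · intro y hy
      rw [mem_iInter] at hy
      choose x hxK hxR using hy
      obtain ⟨a, haK, φ, hφ, hφa⟩ := hK.tendsto_subseq hxK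
      refine ⟨a, haK, fun k => ?_⟩
      -- for `n ≥ k`, `R k (x (φ n)) y`; the `k`-section of `R k` at `y` is closed
      have hsec : IsClosed {x' : X | R k x' y} :=
        (hR k).preimage (Continuous.prodMk_left y)
      refine hsec.mem_of_tendsto hφa ?_
      filter_upwards [eventually_ge_atTop k] with n hn
      exact hanti k (φ n) (hn.trans (hφ.id_le n)) _ _ (hxR (φ n))
    · rintro y ⟨x, hx, hxy⟩
      exact mem_iInter.2 fun k => ⟨x, hx, hxy k⟩
  rw [← hset, hInter]
  exact le_iInf hstage

/-- Measurable-set form of `measure_le_relImage_of_tendsto_of_antitone` for an inner regular limit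
`μ`. [folklore] -/
theorem measure_le_relImage_of_tendsto_of_antitone_of_measurableSet [NeBot L]
    {R : ℕ → X → Y → Prop} (hR : ∀ k, IsClosed {p : X × Y | R k p.1 p.2})
    (hanti : ∀ k l, k ≤ l → ∀ x y, R l x y → R k x y)
    {S : ι → X → Y → Prop} (hS : ∀ k, ∀ᶠ i in L, ∀ x y, S i x y → R k x y)
    {μs : ι → ProbabilityMeasure X} {μ : ProbabilityMeasure X}
    {νs : ι → ProbabilityMeasure Y} {ν : ProbabilityMeasure Y}
    (hμ : Tendsto μs L (𝓝 μ)) (hν : Tendsto νs L (𝓝 ν))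
    (h : ∀ᶠ i in L, ∀ U : Set X, IsOpen U →
      (μs i : Measure X) U ≤ (νs i : Measure Y) {y | ∃ x ∈ U, S i x y})
    [(μ : Measure X).InnerRegularCompactLTTop] {A : Set X} (hA : MeasurableSet A) :
    (μ : Measure X) A ≤ (ν : Measure Y) {y | ∃ x ∈ A, ∀ k, R k x y} := by
  refine le_of_forall_lt fun r hr => ?_
  obtain ⟨K, hKA, hK, hrK⟩ := hA.exists_lt_isCompact_of_ne_top (measure_ne_top _ _) hr
  refine hrK.trans_le ((measure_le_relImage_of_tendsto_of_antitone hR hanti hS hμ hν h hK).trans ?_)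
  exact measure_mono fun y ⟨x, hx, hxy⟩ => ⟨x, hKA hx, hxy⟩

end Closure

/-! ### The same from full Hall/Strassen domination `StochDominatedAlong` at the stages -/

namespace StochDominatedAlong

variable [MeasurableSpace X] [OpensMeasurableSpace X] [MeasurableSpace Y] [OpensMeasurableSpace Y]
  {ι : Type*} {L : Filter ι}

/-- **Stochastic domination along a closed relation passes to weak limits (compact sets)**: if
`μs i ≼_R νs i` eventually (`StochDominatedAlong`), `R` has closed graph and `μs → μ`, `νs → ν`
weakly, then `μ K ≤ ν (R[K])` for compact `K`. [folklore] -/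
theorem measure_le_of_tendsto_of_isCompact [NeBot L] {R : X → Y → Prop}
    (hR : IsClosed {p : X × Y | R p.1 p.2})
    {μs : ι → ProbabilityMeasure X} {μ : ProbabilityMeasure X}
    {νs : ι → ProbabilityMeasure Y} {ν : ProbabilityMeasure Y}
    (hμ : Tendsto μs L (𝓝 μ)) (hν : Tendsto νs L (𝓝 ν))
    (h : ∀ᶠ i in L, StochDominatedAlong R (μs i : Measure X) (νs i : Measure Y))
    {K : Set X} (hK : IsCompact K) :
    (μ : Measure X) K ≤ (ν : Measure Y) {y | ∃ x ∈ K, R x y} :=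
  measure_le_relImage_of_tendsto_of_isCompact hR hμ hν (h.mono fun _ hi U _ => hi U) hK

/-- **Stochastic domination along a closed relation passes to weak limits (measurable sets)**, for
an inner regular limit `μ`. [folklore] -/
theorem measure_le_of_tendsto_of_measurableSet [NeBot L] {R : X → Y → Prop}
    (hR : IsClosed {p : X × Y | R p.1 p.2})
    {μs : ι → ProbabilityMeasure X} {μ : ProbabilityMeasure X}
    {νs : ι → ProbabilityMeasure Y} {ν : ProbabilityMeasure Y}
    (hμ : Tendsto μs L (𝓝 μ)) (hν : Tendsto νs L (𝓝 ν))
    (h : ∀ᶠ i in L, StochDominatedAlong R (μs i : Measure X) (νs i : Measure Y))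
    [(μ : Measure X).InnerRegularCompactLTTop] {A : Set X} (hA : MeasurableSet A) :
    (μ : Measure X) A ≤ (ν : Measure Y) {y | ∃ x ∈ A, R x y} :=
  measure_le_relImage_of_tendsto_of_measurableSet hR hμ hν (h.mono fun _ hi U _ => hi U) hA

/-- **Asymptotic domination along decreasing closed relations**, from `StochDominatedAlong (S i)`
at the stages (compact sets). [folklore] -/
theorem measure_le_of_tendsto_of_antitone [NeBot L] {R : ℕ → X → Y → Prop}
    (hR : ∀ k, IsClosed {p : X × Y | R k p.1 p.2}) (hanti : ∀ k l, k ≤ l → ∀ x y, R l x y → R k x y)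
    {S : ι → X → Y → Prop} (hS : ∀ k, ∀ᶠ i in L, ∀ x y, S i x y → R k x y)
    {μs : ι → ProbabilityMeasure X} {μ : ProbabilityMeasure X}
    {νs : ι → ProbabilityMeasure Y} {ν : ProbabilityMeasure Y}
    (hμ : Tendsto μs L (𝓝 μ)) (hν : Tendsto νs L (𝓝 ν))
    (h : ∀ᶠ i in L, StochDominatedAlong (S i) (μs i : Measure X) (νs i : Measure Y))
    {K : Set X} (hK : IsCompact K) :
    (μ : Measure X) K ≤ (ν : Measure Y) {y | ∃ x ∈ K, ∀ k, R k x y} :=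
  measure_le_relImage_of_tendsto_of_antitone hR hanti hS hμ hν (h.mono fun _ hi U _ => hi U) hK

/-- Measurable-set form of `measure_le_of_tendsto_of_antitone`. [folklore] -/
theorem measure_le_of_tendsto_of_antitone_of_measurableSet [NeBot L] {R : ℕ → X → Y → Prop}
    (hR : ∀ k, IsClosed {p : X × Y | R k p.1 p.2}) (hanti : ∀ k l, k ≤ l → ∀ x y, R l x y → R k x y)
    {S : ι → X → Y → Prop} (hS : ∀ k, ∀ᶠ i in L, ∀ x y, S i x y → R k x y)
    {μs : ι → ProbabilityMeasure X} {μ : ProbabilityMeasure X}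
    {νs : ι → ProbabilityMeasure Y} {ν : ProbabilityMeasure Y}
    (hμ : Tendsto μs L (𝓝 μ)) (hν : Tendsto νs L (𝓝 ν))
    (h : ∀ᶠ i in L, StochDominatedAlong (S i) (μs i : Measure X) (νs i : Measure Y))
    [(μ : Measure X).InnerRegularCompactLTTop] {A : Set X} (hA : MeasurableSet A) :
    (μ : Measure X) A ≤ (ν : Measure Y) {y | ∃ x ∈ A, ∀ k, R k x y} :=
  measure_le_relImage_of_tendsto_of_antitone_of_measurableSet hR hanti hS hμ hν
    (h.mono fun _ hi U _ => hi U) hA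

end StochDominatedAlong

end Literature.Probability.RandomPlanarGeometry

end
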